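import Literature.Geometry.Lorentzian.KerrTimelikeSpan
import HarnessLib

/-!
# The Hawking Killing field `K = T + ω₊ Φ` is timelike on a collar of the horizon
# (Dafermos–Rodnianski–Shlapentokh-Rothman, Lemma 4.7.2)

(family `gr`, infrastructure for statement **gr.S24**; namespace `Literature.Geometry.Lorentzian.Kerr`)

Companion of `KerrTimelikeSpan.lean` (DRSR Lemma 4.7.1). Dafermos–Rodnianski–Shlapentokh-Rothman
(arXiv:1402.7034 = Ann. of Math. 183 (2016), §4.7, Lemma 4.7.2) note, "as a trivial consequence of
positivity of surface gravity": *there exists `ε₀ > 0` such that the vector field `T + (a/(2Mr₊)) Φ`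
is timelike for `r ∈ (r₊, r₊ + ε₀)`*. Here `K = T + ω₊ Φ`, `ω₊ = a/(2Mr₊)`
(`Kerr.horizonAngularVelocity`), is the Killing field which is the null generator of `𝓗⁺`
(loc. cit. §2.2.2); its `ε₀` is consumed in the continuity argument (loc. cit. §11.2,
"Openness", Def. 11.2.1: the interpolating field `V = T + α(r)Φ` equals `T + ω₊Φ` on
`[r₊, r₊ + ε₀/2]` and the field of Lemma 4.7.1 on `[r₊ + ε₀, M(7 + √2)/4]`). This file **proves**
it for the prelude's Kerr metric in ingoing Kerr–Schild Cartesian coordinates, following the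
printed proof:

* `Kerr.hawkingVector M a x = ∂₀ + ω₊ (x₁ ∂₂ − x₂ ∂₁)`, `Kerr.hawkingField` (`= T + ω₊ Φ`,
  `hawkingField_eq`); on `{r = r₊}` it is the field of Lemma 4.7.1
  (`drsrVector_eq_hawkingVector_of_radius_eq`), whence `K` is null on `𝓗⁺`
  (`isNull_hawkingField`, from `isNull_drsrField`);
* `g(T + cΦ, T + cΦ)` for a constant `c` in the variables `(r, σ = sin²θ)`
  (`bilin_basisVector_add_smul_axialVector`) and the Boyer–Lindquist form of the printed proof,
  `ρ² g(K, K) = −Δ + σ (a² − 2a²r/r₊ + a²(r² + a²)²/(4M²r₊²) − a⁴σΔ/(4M²r₊²))`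
  (`hawking_rho_sq_mul_eq`);
* the printed `F(r) = −Δ + a² − 2a²r/r₊ + a²(r² + a²)²/(4M²r₊²)` with `F(r₊) = 0`, factored as
  `F = (r − r₊) G` with an explicit cubic `G` (`hawking_F_factor`), and
  `G(r₊) = F'(r₊) = −2(r₊ − M) − 2a²/r₊ + 2a²/M < 0` for `|a| < M` (`hawking_G_rPlus_neg`, the
  printed computation with `r₊ = M + √(M² − a²)`);
* **Lemma 4.7.2**: `∃ ε₀ > 0`, `g(K, K) < 0` whenever `r₊ < r < r₊ + ε₀`
  (`exists_bilin_hawkingVector_neg`, manifold form `isTimelike_hawkingField` on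
  `Kerr.exterior M a`); `ε₀` comes from continuity of the polynomial `G` at `r₊`, as printed
  (no explicit value is claimed).

## References

* M. Dafermos, I. Rodnianski, Y. Shlapentokh-Rothman, *Decay for solutions of the wave equation
  on Kerr exterior spacetimes III: the full subextremal case `|a| < M`*, Ann. of Math. 183 (2016)
  787–913, arXiv:1402.7034: §2.2.2 (`K = T + ω₊Φ`), §4.7 Lemma 4.7.2, §11.2 Def. 11.2.1
  (key `DafermosRodnianskiShlapentokhrothman2014`).
-/

noncomputable section

open scoped Manifold ContDiff

namespace Literature.Geometry.Lorentzian

namespace Kerr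

/-! ### Lemma 4.7.2: the Hawking field `K = T + ω₊ Φ` is timelike on a collar of the horizon -/

/-- The **Hawking vector** `K = T + ω₊ Φ = ∂₀ + (a/(2Mr₊)) (x₁ ∂₂ − x₂ ∂₁)` at `x` (constant
angular velocity `ω₊ = Kerr.horizonAngularVelocity M a`): the Killing field whose restriction to
`𝓗⁺` is the null generator. Junk value: when `M r₊ = 0` (e.g. `M = 0`), `ω₊ = 0` and `K = T`.
DRSR arXiv:1402.7034, §2.2.2 and Lemma 4.7.2. [cite: DafermosRodnianskiShlapentokhrothman2014, §2.2.2] -/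
def hawkingVector (M a : ℝ) (x : E4) : E4 :=
  E4.basisVector 0 + horizonAngularVelocity M a • axialVector x

/-- The Hawking Killing field `K = T + ω₊ Φ` as a section of `T(Kerr.region a r₀)`.
DRSR arXiv:1402.7034, §2.2.2. [cite: DafermosRodnianskiShlapentokhrothman2014, §2.2.2] -/
def hawkingField (M a r₀ : ℝ) : Π x : region a r₀, TangentSpace 𝓘(ℝ, E4) x :=
  fun x ↦ hawkingVector M a x.1

/-- `hawkingField = T + ω₊ Φ` in terms of `Kerr.stationaryField` and `Kerr.axialField` (`rfl`).
DRSR arXiv:1402.7034, §2.2.2. [cite: DafermosRodnianskiShlapentokhrothman2014, §2.2.2] -/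
theorem hawkingField_eq (M a r₀ : ℝ) (x : region a r₀) :
    hawkingField M a r₀ x =
      stationaryField a r₀ x + horizonAngularVelocity M a • axialField a r₀ x :=
  rfl

/-- On the horizon `{r = r₊}` the DRSR field `T + (2Mar/(r² + a²)²) Φ` of Lemma 4.7.1
(`Kerr.drsrVector`) **is** the Hawking field `K = T + ω₊ Φ` (`ω(r₊) = ω₊`,
`drsrAngularVelocity_rPlus`), so that `isNull_drsrField` of `KerrTimelikeSpan.lean` is the
statement "`K` is null on `𝓗⁺`" (DRSR arXiv:1402.7034, §2.2.2). Needs `|a| ≤ M`, `0 < M`.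
[cite: DafermosRodnianskiShlapentokhrothman2014, §2.2.2] -/
theorem drsrVector_eq_hawkingVector_of_radius_eq {M a : ℝ} (h : |a| ≤ M) (hM : 0 < M) {x : E4}
    (hx : radius a x = rPlus M a) : drsrVector M a x = hawkingVector M a x := by
  rw [drsrVector, hawkingVector, hx, drsrAngularVelocity_rPlus h hM]

/-- **`K` is null on the horizon**: at every point of `Kerr.region a r₀` with `r = r₊`, the
Hawking field is null for `Kerr.metric M a r₀` (`|a| ≤ M`, `0 < M`); a restatement of
`isNull_drsrField` through `drsrVector_eq_hawkingVector_of_radius_eq`. DRSR arXiv:1402.7034,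
§2.2.2 ("`K` … is null and normal to `𝓗⁺`") and Lemma 4.7.1. [cite: DafermosRodnianskiShlapentokhrothman2014, §2.2.2] -/
theorem isNull_hawkingField [Facts] {M a : ℝ} (h : |a| ≤ M) (hM : 0 < M) {r₀ : ℝ}
    (x : region a r₀) (hx : radius a x.1 = rPlus M a) :
    (metric M a r₀).IsNull (hawkingField M a r₀ x) := by
  have := isNull_drsrField h hM x hx
  rwa [drsrField, drsrVector_eq_hawkingVector_of_radius_eq h hM hx] at this

/-- **`g(T + cΦ, T + cΦ)` for a constant `c`**, in the variables `(r, σ)`, `σ = (r² − x₃²)/r²`: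
`−1 + c² σ (r² + a²) + (2Mr/(r² + a²(1 − σ))) (1 − c a σ)²` wherever `r > 0` (same computation as
`bilin_drsrVector_eq_of_radius_pos`). DRSR arXiv:1402.7034, proof of Lemma 4.7.2. [folklore] -/
theorem bilin_basisVector_add_smul_axialVector (M a c : ℝ) {x : E4} (hr : 0 < radius a x) :
    bilin M a x (E4.basisVector 0 + c • axialVector x) (E4.basisVector 0 + c • axialVector x) =
      -1 + c ^ 2 * ((radius a x ^ 2 - x 3 ^ 2) / radius a x ^ 2 * (radius a x ^ 2 + a ^ 2)) +
        2 * M * radius a x / (radius a x ^ 2 + a ^ 2 * (1 - (radius a x ^ 2 - x 3 ^ 2) /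
          radius a x ^ 2)) * (1 - c * (a * ((radius a x ^ 2 - x 3 ^ 2) / radius a x ^ 2))) ^ 2 := by
  set r := radius a x with hr_def
  have h1 := minkowski_basisVector_zero_axialVector x
  have h2 : Minkowski.bilin (axialVector x) (E4.basisVector 0) = 0 := by
    rw [Minkowski.bilin_symm, h1]
  have hη : Minkowski.bilin (E4.basisVector 0 + c • axialVector x)
      (E4.basisVector 0 + c • axialVector x) = -1 + c ^ 2 * (x 1 ^ 2 + x 2 ^ 2) := by
    simp only [map_add, map_smul, _root_.add_apply, FunLike.coe_smul, Pi.smul_apply,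
      smul_eq_mul, h1, h2, Minkowski.bilin_basisVector_zero, minkowski_axialVector]
    ring
  have hℓ : nullCovector a x (E4.basisVector 0 + c • axialVector x) =
      1 - c * (a * (x 1 ^ 2 + x 2 ^ 2) / (r ^ 2 + a ^ 2)) := by
    rw [map_add, map_smul, nullCovector_basisVector_zero, nullCovector_axialVector, smul_eq_mul]
    ring
  have h12 : x 1 ^ 2 + x 2 ^ 2 = (r ^ 2 - x 3 ^ 2) / r ^ 2 * (r ^ 2 + a ^ 2) := by
    rw [sq_add_sq_eq a hr]
    ring
  have hq : a * (x 1 ^ 2 + x 2 ^ 2) / (r ^ 2 + a ^ 2) = a * ((r ^ 2 - x 3 ^ 2) / r ^ 2) := by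
    rw [h12]
    have : r ^ 2 + a ^ 2 ≠ 0 := by positivity
    field_simp
  rw [bilin_apply, hη, hℓ, hq, h12, scalarH_eq_div M a hr, ← hr_def]
  ring

/-- **The Boyer–Lindquist form for `K = T + ω₊Φ`** (DRSR arXiv:1402.7034, proof of Lemma 4.7.2,
first display): with `ρ² = r² + a²(1 − σ)`, `σ = sin²θ` and `ω₊ = a/(2Mr₊)`,
`ρ² g(K, K) = −Δ + σ (a² − 2a²r/r₊ + a²(r² + a²)²/(4M²r₊²) − a⁴σΔ/(4M²r₊²))`, valid for
`M r₊ ≠ 0`, `r² + a²(1 − σ) ≠ 0`. [cite: DafermosRodnianskiShlapentokhrothman2014, Lemma 4.7.2 (proof)] -/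
theorem hawking_rho_sq_mul_eq {M a r σ : ℝ} (hMr : 2 * M * rPlus M a ≠ 0)
    (hD : r ^ 2 + a ^ 2 * (1 - σ) ≠ 0) :
    (r ^ 2 + a ^ 2 * (1 - σ)) * (-1 + horizonAngularVelocity M a ^ 2 * (σ * (r ^ 2 + a ^ 2)) +
        2 * M * r / (r ^ 2 + a ^ 2 * (1 - σ)) * (1 - horizonAngularVelocity M a * (a * σ)) ^ 2) =
      -(r ^ 2 - 2 * M * r + a ^ 2) + σ * (a ^ 2 - 2 * a ^ 2 * r / rPlus M a +
        a ^ 2 * (r ^ 2 + a ^ 2) ^ 2 / (4 * M ^ 2 * rPlus M a ^ 2) -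
        a ^ 4 * σ * (r ^ 2 - 2 * M * r + a ^ 2) / (4 * M ^ 2 * rPlus M a ^ 2)) := by
  unfold horizonAngularVelocity
  have hM : M ≠ 0 := by rintro rfl; simp at hMr
  have hr : rPlus M a ≠ 0 := by rintro h; simp [h] at hMr
  field_simp
  ring

/-- **The function `F` of the printed proof and its derivative at the horizon.** With
`F(r) = −Δ + a² − 2a²r/r₊ + a²(r² + a²)²/(4M²r₊²)`: `F(r₊) = 0` and `F(r) = (r − r₊) G(r)` for the
explicit cubic `G(r) = −(r + r₊) + 2M − 2a²/r₊ + a²(r + r₊)(r² + r₊² + 2a²)/(4M²r₊²)`, whose value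
`G(r₊) = −2(r₊ − M) − 2a²/r₊ + 2a²/M = F'(r₊)` is negative for `|a| < M` (loc. cit., last display of the proof:
`−2√(M² − a²) − 2a²/(M + √(M² − a²)) + 2a²/M < 0`). DRSR arXiv:1402.7034, proof of Lemma 4.7.2.
[cite: DafermosRodnianskiShlapentokhrothman2014, Lemma 4.7.2 (proof)] -/
theorem hawking_F_factor {M a : ℝ} (h : |a| ≤ M) (hM : 0 < M) (r : ℝ) :
    -(r ^ 2 - 2 * M * r + a ^ 2) + (a ^ 2 - 2 * a ^ 2 * r / rPlus M a +
        a ^ 2 * (r ^ 2 + a ^ 2) ^ 2 / (4 * M ^ 2 * rPlus M a ^ 2)) =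
      (r - rPlus M a) * (-(r + rPlus M a) + 2 * M - 2 * a ^ 2 / rPlus M a +
        a ^ 2 * (r + rPlus M a) * (r ^ 2 + rPlus M a ^ 2 + 2 * a ^ 2) /
          (4 * M ^ 2 * rPlus M a ^ 2)) := by
  have hr : 0 < rPlus M a := by
    unfold rPlus; linarith [Real.sqrt_nonneg (M ^ 2 - a ^ 2)]
  have hA := rPlus_sq_add_sq h
  field_simp
  linear_combination (-4 * M ^ 2 * rPlus M a ^ 2 + a ^ 2 * rPlus M a ^ 2 + a ^ 4 +
    2 * M * a ^ 2 * rPlus M a) * hA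

/-- `G(r₊) = F'(r₊) < 0` for subextremal parameters: with `s = √(M² − a²) > 0`,
`G(r₊) = −2s − 2a²/(M + s) + 2a²/M = 2s (a²/(M(M + s)) − 1) < 0`. DRSR arXiv:1402.7034, proof of
Lemma 4.7.2 (last display). [cite: DafermosRodnianskiShlapentokhrothman2014, Lemma 4.7.2 (proof)] -/
theorem hawking_G_rPlus_neg {M a : ℝ} (hMa : IsSubextremal M a) :
    -(rPlus M a + rPlus M a) + 2 * M - 2 * a ^ 2 / rPlus M a +
        a ^ 2 * (rPlus M a + rPlus M a) * (rPlus M a ^ 2 + rPlus M a ^ 2 + 2 * a ^ 2) /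
          (4 * M ^ 2 * rPlus M a ^ 2) < 0 := by
  have hM := hMa.pos
  have ha2 : a ^ 2 < M ^ 2 := sq_lt_sq' (abs_lt.1 hMa).1 (abs_lt.1 hMa).2
  have hs : 0 < √(M ^ 2 - a ^ 2) := Real.sqrt_pos.2 (by linarith)
  have hs2 : √(M ^ 2 - a ^ 2) ^ 2 = M ^ 2 - a ^ 2 := Real.sq_sqrt (by linarith)
  have hr : 0 < rPlus M a := by unfold rPlus; linarith
  have hA := rPlus_sq_add_sq hMa.le
  -- rewrite to the printed `−2(r₊ − M) − 2a²/r₊ + 2a²/M`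
  have hG : -(rPlus M a + rPlus M a) + 2 * M - 2 * a ^ 2 / rPlus M a +
      a ^ 2 * (rPlus M a + rPlus M a) * (rPlus M a ^ 2 + rPlus M a ^ 2 + 2 * a ^ 2) /
        (4 * M ^ 2 * rPlus M a ^ 2) =
      -2 * (rPlus M a - M) - 2 * a ^ 2 / rPlus M a + 2 * a ^ 2 / M := by
    field_simp
    linear_combination (4 * a ^ 2) * hA
  rw [hG]
  -- `r₊ = M + s`: the printed computation, `= 2s (a² − M² − Ms)/(M(M + s)) < 0`
  have hrs : rPlus M a = M + √(M ^ 2 - a ^ 2) := rfl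
  rw [hrs] at hr ⊢
  set s := √(M ^ 2 - a ^ 2) with hs_def
  have key : -2 * (M + s - M) - 2 * a ^ 2 / (M + s) + 2 * a ^ 2 / M =
      2 * s * (a ^ 2 - M ^ 2 - M * s) / (M * (M + s)) := by
    field_simp
    ring
  rw [key]
  exact div_neg_of_neg_of_pos (mul_neg_of_pos_of_neg (by positivity) (by nlinarith))
    (by positivity)

/-- **DRSR Lemma 4.7.2, coordinate form.** For subextremal `(M, a)` there is `ε₀ > 0` such that
`g_{M,a}(x)(K, K) < 0`, `K = T + ω₊ Φ`, at every point `x` of the Kerr–Schild chart with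
`r₊ < r(x) < r₊ + ε₀`. Proof as printed: `ρ² g(K, K) = −(1 − σ)Δ + σ F(r) − a⁴σ²Δ/(4M²r₊²)` with
`Δ > 0`, and `F = (r − r₊) G` with `G(r₊) < 0`, so `F < 0` on a right-collar of `r₊` by continuity
of the polynomial `G`. [cite: DafermosRodnianskiShlapentokhrothman2014, Lemma 4.7.2] -/
theorem exists_bilin_hawkingVector_neg {M a : ℝ} (hMa : IsSubextremal M a) :
    ∃ ε₀ : ℝ, 0 < ε₀ ∧ ∀ x : E4, rPlus M a < radius a x → radius a x < rPlus M a + ε₀ →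
      bilin M a x (hawkingVector M a x) (hawkingVector M a x) < 0 := by
  have hM := hMa.pos
  have hle : |a| ≤ M := hMa.le
  have hrp : 0 < rPlus M a := by
    unfold rPlus; linarith [Real.sqrt_nonneg (M ^ 2 - a ^ 2)]
  -- the cubic `G` and a right-collar on which it is negative
  set G : ℝ → ℝ := fun r ↦ -(r + rPlus M a) + 2 * M - 2 * a ^ 2 / rPlus M a +
    a ^ 2 * (r + rPlus M a) * (r ^ 2 + rPlus M a ^ 2 + 2 * a ^ 2) / (4 * M ^ 2 * rPlus M a ^ 2)
    with hG_def
  have hGc : Continuous G := by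
    simp only [hG_def]
    fun_prop
  have hG0 : G (rPlus M a) < 0 := by
    simp only [hG_def]
    exact hawking_G_rPlus_neg hMa
  obtain ⟨ε₀, hε₀, hε⟩ := Metric.eventually_nhds_iff.1
    (hGc.continuousAt.eventually (eventually_lt_nhds hG0))
  refine ⟨ε₀, hε₀, fun x hx1 hx2 ↦ ?_⟩
  have hr : 0 < radius a x := hrp.trans hx1
  set r := radius a x with hr_def
  have hGr : G r < 0 := hε (by rw [Real.dist_eq, abs_lt]; constructor <;> linarith)
  -- `σ = sin²θ ∈ [0, 1]`, `ρ² > 0`, `Δ > 0`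
  set σ : ℝ := (r ^ 2 - x 3 ^ 2) / r ^ 2 with hσ_def
  obtain ⟨hσ0, hσ1⟩ := sinSq_nonneg_and_le_one a hr
  rw [← hr_def, ← hσ_def] at hσ0 hσ1
  have hD : 0 < r ^ 2 + a ^ 2 * (1 - σ) := by
    have : 0 ≤ a ^ 2 * (1 - σ) := mul_nonneg (sq_nonneg a) (by linarith)
    positivity
  have hΔ : 0 < r ^ 2 - 2 * M * r + a ^ 2 := by
    have ha2 : a ^ 2 < M ^ 2 := sq_lt_sq' (abs_lt.1 hMa).1 (abs_lt.1 hMa).2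
    have h1 : √(M ^ 2 - a ^ 2) < r - M := by unfold rPlus at hx1; linarith
    have hs2 : √(M ^ 2 - a ^ 2) ^ 2 = M ^ 2 - a ^ 2 := Real.sq_sqrt (by linarith)
    have h2 : M ^ 2 - a ^ 2 < (r - M) ^ 2 := by nlinarith [Real.sqrt_nonneg (M ^ 2 - a ^ 2)]
    nlinarith
  -- `ρ² g(K,K) = −(1−σ)Δ + σ F(r) − a⁴σ²Δ/(4M²r₊²)` with `F(r) = (r − r₊) G(r) < 0`
  have hF : -(r ^ 2 - 2 * M * r + a ^ 2) + (a ^ 2 - 2 * a ^ 2 * r / rPlus M a +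
      a ^ 2 * (r ^ 2 + a ^ 2) ^ 2 / (4 * M ^ 2 * rPlus M a ^ 2)) < 0 := by
    rw [hawking_F_factor hle hM r]
    exact mul_neg_of_pos_of_neg (sub_pos.2 hx1) hGr
  have hlast : 0 ≤ a ^ 4 * σ * (r ^ 2 - 2 * M * r + a ^ 2) / (4 * M ^ 2 * rPlus M a ^ 2) :=
    div_nonneg (mul_nonneg (mul_nonneg (by positivity) hσ0) hΔ.le) (by positivity)
  have hrhs : -(r ^ 2 - 2 * M * r + a ^ 2) + σ * (a ^ 2 - 2 * a ^ 2 * r / rPlus M a +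
      a ^ 2 * (r ^ 2 + a ^ 2) ^ 2 / (4 * M ^ 2 * rPlus M a ^ 2) -
      a ^ 4 * σ * (r ^ 2 - 2 * M * r + a ^ 2) / (4 * M ^ 2 * rPlus M a ^ 2)) < 0 := by
    -- `= −(1−σ)Δ + σ F − σ·(last) ≤ −(1−σ)Δ + σ F`, and `(1−σ)Δ ≥ 0`, `σF ≤ 0`, not both zero
    rcases eq_or_lt_of_le hσ0 with hσ | hσ
    · rw [← hσ]; simp only [zero_mul, add_zero]; linarith
    · nlinarith [mul_nonneg hσ0 hlast, mul_neg_of_pos_of_neg hσ hF,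
        mul_nonneg (sub_nonneg.2 hσ1) hΔ.le]
  rw [hawkingVector, bilin_basisVector_add_smul_axialVector M a _ hr, ← hr_def, ← hσ_def]
  refine neg_of_mul_neg_right ?_ hD.le
  rw [hawking_rho_sq_mul_eq (by positivity) hD.ne']
  exact hrhs

/-- **DRSR Lemma 4.7.2.** For subextremal `(M, a)` there exists `ε₀ > 0` such that the Hawking
Killing field `K = T + ω₊ Φ` (`Kerr.hawkingField`) is timelike for `Kerr.metric M a r₊` at every
point of the Kerr exterior with `r₊ < r < r₊ + ε₀` ("a trivial consequence of positivity of
surface gravity"). Dafermos–Rodnianski–Shlapentokh-Rothman, arXiv:1402.7034 = Ann. of Math. 183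
(2016), Lemma 4.7.2. [cite: DafermosRodnianskiShlapentokhrothman2014, Lemma 4.7.2] -/
theorem isTimelike_hawkingField [Facts] {M a : ℝ} (hMa : IsSubextremal M a) :
    ∃ ε₀ : ℝ, 0 < ε₀ ∧ ∀ x : exterior M a, radius a x.1 < rPlus M a + ε₀ →
      (metric M a (rPlus M a)).IsTimelike (hawkingField M a (rPlus M a) x) := by
  obtain ⟨ε₀, hε₀, h⟩ := exists_bilin_hawkingVector_neg hMa
  refine ⟨ε₀, hε₀, fun x hx ↦ ?_⟩
  rw [LorentzianMetric.isTimelike_iff, metric_val]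
  exact h x.1 (lt_radius_of_mem_region x.2) hx


end Kerr

end Literature.Geometry.Lorentzian

end
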